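import Literature.MathematicalPhysics.PowerSystems.DroopLoadsSolutionUniqueness

/-!
# DAPI secondary control with load nodes: UNIQUENESS of the solution of the differential-algebraic
# closed loop from consistent initial data near the equilibrium — the index-one DAE well-posedness
# that SPDB2013 Theorem 8 (ii) / App. C presupposes (erratum 2026-08-28: the print's «unique» in
# Theorem 8 (ii) / Theorem 2 (i) qualifies the EQUILIBRIUM in `Δ_G(γ) × ℝ^{|V_I|}`, not trajectories;
# not claimed here) — and a generic uniqueness lemma along a regular solution

Topic `Literature/MathematicalPhysics/PowerSystems` (LADDER-GRIDFUSION rung G3; seat gridfusion-lit-2,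
g13).  Companion of `DroopLoadsSolutionUniqueness.lean` (the same statement for Theorem 2 (i) with
loads) and of `DroopLoadsSolutionExistence.lean` §4 (`DAPINetwork.exists_solution_loads`: from every
consistent `(θ⁰, p⁰)` close to the equilibrium a solution `(θ, p)` of (load – closed
loop)–(secondary control – closed loop) on `[0, ∞)` EXISTS).  This file proves uniqueness in exactly
that class: `θ(0) = θ⁰`, `p(0) = p⁰`, `IsSolutionLoadsAt` at every `t > 0`, the load constraints
at every `t ≥ 0`, the state `(θ, p − D_Iω_avg)` continuous on `[0, ∞)`.  0 named facts.

* §1 **`eq_of_regularSolution`** (generic, any proper real normed space): a `C¹` field `F` on an open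
  set `O`; `X*` solves `ẋ = F(x)` on every `[0, T]` and stays in `O` for `t ≥ 0`; `X` is continuous on
  `[0, ∞)`, solves `ẋ = F(x)` at every `t > 0` with `X(t) ∈ O`, and `X(0) = X*(0)`.  Then `X = X*` on
  `[0, ∞)` (first disagreement time, compact ball in `O`, Lipschitz, right derivative by continuous
  extension, Grönwall) — the argument of the companion's `frame_eq_of_kronSolution`, stated once for
  all;
* §2 **`hasDerivAt_lphase_of_forward`**: a forward solution of the DAPI differential-algebraic
  closed loop, read in the error coordinates `x = (θ, p − D_Iω_avg)`, solves `ẋ = dlField θ* x` at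
  every regular `t > 0` (constraint differentiation applied to the curve frozen at negative times);
  **`solution_unique_loads`** and **`existsUnique_solution_loads`** — TRAJECTORY UNIQUENESS / EXACTLY
  ONE solution in the class for the DAE closed loop of Theorem 8 (ii) with load nodes (the
  well-posedness its stability statement presupposes; with the companion's existence theorem and its
  exponential estimate).

THREE COLUMNS.  Mathematics about the MODEL (load – closed loop)–(secondary control – closed loop)
(lossless, constant voltages, constant-power loads as algebraic rows); classical solutions.
Nothing here says a microgrid is stable.

## References

* J. W. Simpson-Porco, F. Dörfler, F. Bullo, *Synchronization and power sharing for droop-controlled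
  inverters in islanded microgrids*, Automatica 49 (2013) 2603–2611 = arXiv:1206.5033, §5 Theorem 8
  and App. C (held text p0016 L1–L40: error coordinates, «eliminate the resulting algebraic equations,
  as in the proof of Theorem 2»), §3 proof of Theorem 2 (b) (p0008 L23–L49). [SimpsonporcoDorflerBullo2013]
* H. K. Khalil, *Nonlinear Systems*, 3rd ed., Theorem 3.1 (local existence and uniqueness for
  locally Lipschitz right-hand sides). [Khalil2002]

AI-produced formalisation (LADDER-GRIDFUSION seat gridfusion-lit-2 g13, 2026-08-28).
-/

noncomputable section

open Set Filter Topology Finset Metric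
open scoped Matrix BigOperators NNReal

namespace Literature.MathematicalPhysics.PowerSystems

/-! ## §1 Uniqueness along a regular solution of a field that is `C¹` on an open set -/

/-- **Uniqueness along a regular solution.**  `F` is `C¹` on the open set `O` of a proper real normed
space; `X*` solves `ẋ = F(x)` on every `[0, T]` (one-sided derivatives at the ends) with
`X*(t) ∈ O` for `t ≥ 0`; `X` is continuous on `[0, ∞)` and solves `ẋ = F(x)` at every `t > 0` at
which `X(t) ∈ O`; `X(0) = X*(0)`.  Then `X(t) = X*(t)` for all `t ≥ 0`.
[cite: Khalil2002, Theorem 3.1 (uniqueness for locally Lipschitz right-hand sides); SimpsonporcoDorflerBullo2013, §3 proof of Theorem 2 (b) (p0008 L23–L49) and App. C (p0016 L24)] -/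
theorem eq_of_regularSolution {E : Type*} [NormedAddCommGroup E] [NormedSpace ℝ E] [ProperSpace E]
    {F : E → E} {O : Set E} (hO : IsOpen O) (hF : ContDiffOn ℝ 1 F O) {X Xs : ℝ → E}
    (hXs : ∀ T : ℝ, ∀ t ∈ Icc 0 T, HasDerivWithinAt Xs (F (Xs t)) (Icc 0 T) t)
    (hXsO : ∀ t, 0 ≤ t → Xs t ∈ O) (hXc : ContinuousOn X (Ici 0))
    (hXd : ∀ t, 0 < t → X t ∈ O → HasDerivAt X (F (X t)) t) (h0 : X 0 = Xs 0) :
    ∀ t, 0 ≤ t → X t = Xs t := by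
  have hXsc : ∀ T, ContinuousOn Xs (Icc 0 T) := fun T t ht => (hXs T t ht).continuousWithinAt
  by_contra hcon
  push Not at hcon
  obtain ⟨t₂, ht₂, hne₂⟩ := hcon
  set D : Set ℝ := {t | 0 ≤ t ∧ X t ≠ Xs t} with hD
  have hDne : D.Nonempty := ⟨t₂, ht₂, hne₂⟩
  have hDbdd : BddBelow D := ⟨0, fun t ht => ht.1⟩
  set t₁ : ℝ := sInf D with ht₁
  have ht₁0 : 0 ≤ t₁ := le_csInf hDne fun t ht => ht.1
  have hbefore : ∀ t, 0 ≤ t → t < t₁ → X t = Xs t := by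
    intro t ht htt
    by_contra hne
    exact absurd (csInf_le hDbdd ⟨ht, hne⟩) (not_le.2 htt)
  -- agreement at `t₁`
  have heq₁ : X t₁ = Xs t₁ := by
    rcases ht₁0.eq_or_lt with h | h
    · rw [← h]; exact h0
    · have hc : ContinuousWithinAt (fun t => X t - Xs t) (Icc 0 t₁) t₁ :=
        ((hXc.mono fun t (ht : t ∈ Icc 0 t₁) => ht.1) t₁ ⟨h.le, le_rfl⟩).sub
          ((hXsc t₁) t₁ ⟨h.le, le_rfl⟩)
      have hIco : Ico 0 t₁ ⊆ Icc 0 t₁ := fun t ht => ⟨ht.1, ht.2.le⟩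
      have htend : Tendsto (fun t => X t - Xs t) (𝓝[Ico 0 t₁] t₁) (𝓝 (X t₁ - Xs t₁)) :=
        (hc.mono hIco).tendsto
      have hmem : t₁ ∈ closure (Ico 0 t₁) := by
        rw [closure_Ico h.ne]; exact right_mem_Icc.2 h.le
      haveI : (𝓝[Ico 0 t₁] t₁).NeBot := mem_closure_iff_nhdsWithin_neBot.1 hmem
      have hzero : Tendsto (fun t => X t - Xs t) (𝓝[Ico 0 t₁] t₁) (𝓝 0) := by
        refine tendsto_const_nhds.congr' ?_
        exact eventually_nhdsWithin_of_forall fun t ht => by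
          show (0 : E) = X t - Xs t
          rw [hbefore t ht.1 ht.2, sub_self]
      exact sub_eq_zero.1 (tendsto_nhds_unique htend hzero)
  -- a compact ball in `O` around `X*(t₁)`, on which `F` is Lipschitz
  obtain ⟨r, hr, hball⟩ := Metric.isOpen_iff.1 hO (Xs t₁) (hXsO t₁ ht₁0)
  set K : Set E := closedBall (Xs t₁) (r / 2) with hK
  have hKc : IsCompact K := isCompact_closedBall _ _
  have hKO : K ⊆ O := (closedBall_subset_ball (by linarith)).trans hball
  obtain ⟨C, hC⟩ := Literature.Analysis.ODE.exists_lipschitzOnWith_of_isCompact hO hF hKc hKO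
  -- continuity: both curves stay in `K` on `[t₁, t₁ + δ]`
  have hXc₁ : ContinuousWithinAt X (Ici t₁) t₁ :=
    (hXc.mono fun t (ht : t ∈ Ici t₁) => ht₁0.trans ht) t₁ (mem_Ici.2 le_rfl)
  have hXsc₁ : ContinuousWithinAt Xs (Icc t₁ (t₁ + 1)) t₁ :=
    ((hXsc (t₁ + 1)).mono fun t (ht : t ∈ Icc t₁ (t₁ + 1)) => ⟨ht₁0.trans ht.1, ht.2⟩) t₁
      ⟨le_rfl, by linarith⟩
  obtain ⟨δ₁, hδ₁, hX₁⟩ : ∃ δ > 0, ∀ t ∈ Ici t₁, dist t t₁ < δ → dist (X t) (X t₁) < r / 2 :=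
    Metric.continuousWithinAt_iff.1 hXc₁ (r / 2) (by linarith)
  obtain ⟨δ₂, hδ₂, hXs₁⟩ : ∃ δ > 0, ∀ t ∈ Icc t₁ (t₁ + 1), dist t t₁ < δ →
      dist (Xs t) (Xs t₁) < r / 2 :=
    Metric.continuousWithinAt_iff.1 hXsc₁ (r / 2) (by linarith)
  set δ : ℝ := min (min δ₁ δ₂) 1 / 2 with hδ
  have hδpos : 0 < δ := by rw [hδ]; positivity
  have hδ1 : δ < δ₁ := by
    have := min_le_left (min δ₁ δ₂) 1; have := min_le_left δ₁ δ₂; rw [hδ]; linarith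
  have hδ2 : δ < δ₂ := by
    have := min_le_left (min δ₁ δ₂) 1; have := min_le_right δ₁ δ₂; rw [hδ]; linarith
  have hδone : δ < 1 := by have := min_le_right (min δ₁ δ₂) 1; rw [hδ]; linarith
  have hXK : ∀ t ∈ Icc t₁ (t₁ + δ), X t ∈ K := by
    intro t ht
    have hd : dist t t₁ < δ₁ := by
      rw [Real.dist_eq, abs_of_nonneg (by linarith [ht.1])]; linarith [ht.2]
    have h1 := hX₁ t ht.1 hd
    rw [heq₁] at h1
    exact mem_closedBall.2 h1.le
  have hXsK : ∀ t ∈ Icc t₁ (t₁ + δ), Xs t ∈ K := by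
    intro t ht
    have hd : dist t t₁ < δ₂ := by
      rw [Real.dist_eq, abs_of_nonneg (by linarith [ht.1])]; linarith [ht.2]
    exact mem_closedBall.2 (hXs₁ t ⟨ht.1, by linarith [ht.2]⟩ hd).le
  -- derivatives within `Ici t` on `[t₁, t₁ + δ)`
  have hXs' : ∀ t ∈ Ico t₁ (t₁ + δ), HasDerivWithinAt Xs (F (Xs t)) (Ici t) t := by
    intro t ht
    have h := hXs (t₁ + 1) t ⟨ht₁0.trans ht.1, by linarith [ht.2]⟩
    refine h.mono_of_mem_nhdsWithin ?_
    have hlt : t < t₁ + 1 := by linarith [ht.2]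
    exact mem_of_superset (Icc_mem_nhdsGE hlt) fun s hs => ⟨(ht₁0.trans ht.1).trans hs.1, hs.2⟩
  have hXder : ∀ t ∈ Ioo t₁ (t₁ + δ), HasDerivAt X (F (X t)) t := by
    intro t ht
    exact hXd t (lt_of_le_of_lt ht₁0 ht.1) (hKO (hXK t ⟨ht.1.le, ht.2.le⟩))
  have hX₁' : HasDerivWithinAt X (F (X t₁)) (Ici t₁) t₁ := by
    have hs : Ioo t₁ (t₁ + δ) ∈ 𝓝[>] t₁ := Ioo_mem_nhdsGT (by linarith)
    have f_diff : DifferentiableOn ℝ X (Ioo t₁ (t₁ + δ)) := fun t ht =>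
      (hXder t ht).differentiableAt.differentiableWithinAt
    have f_lim : ContinuousWithinAt X (Ioo t₁ (t₁ + δ)) t₁ := hXc₁.mono fun t ht => ht.1.le
    have hFc : ContinuousAt F (X t₁) :=
      hF.continuousOn.continuousAt (hO.mem_nhds (hKO (hXK t₁ ⟨le_rfl, by linarith⟩)))
    have hXlim : Tendsto X (𝓝[>] t₁) (𝓝 (X t₁)) :=
      (hXc₁.mono fun t (ht : t ∈ Ioi t₁) => (mem_Ioi.1 ht).le).tendsto
    have f_lim' : Tendsto (fun t => deriv X t) (𝓝[>] t₁) (𝓝 (F (X t₁))) := by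
      refine (hFc.tendsto.comp hXlim).congr' ?_
      filter_upwards [hs] with t ht
      exact ((hXder t ht).deriv).symm
    exact hasDerivWithinAt_Ici_of_tendsto_deriv f_diff f_lim hs f_lim'
  have hX' : ∀ t ∈ Ico t₁ (t₁ + δ), HasDerivWithinAt X (F (X t)) (Ici t) t := by
    intro t ht
    rcases ht.1.eq_or_lt with h | h
    · rw [← h]; exact hX₁'
    · exact (hXder t ⟨h, ht.2⟩).hasDerivWithinAt
  -- Grönwall on `[t₁, t₁ + δ]`
  have hXcI : ContinuousOn X (Icc t₁ (t₁ + δ)) := hXc.mono fun t ht => ht₁0.trans ht.1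
  have hXscI : ContinuousOn Xs (Icc t₁ (t₁ + δ)) :=
    (hXsc (t₁ + 1)).mono fun t ht => ⟨ht₁0.trans ht.1, by linarith [ht.2]⟩
  have hgr := dist_le_of_trajectories_ODE_of_mem (v := fun _ => F) (s := fun _ => K) (K := C)
    (f := X) (g := Xs) (a := t₁) (b := t₁ + δ) (δ := 0) (fun _ _ => hC) hXcI hX'
    (fun t ht => hXK t ⟨ht.1, ht.2.le⟩) hXscI hXs' (fun t ht => hXsK t ⟨ht.1, ht.2.le⟩)
    (by rw [heq₁, dist_self])
  have hagree : ∀ t ∈ Icc t₁ (t₁ + δ), X t = Xs t := fun t ht => by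
    have h := hgr t ht
    rw [zero_mul] at h
    exact dist_le_zero.1 h
  obtain ⟨t₃, ht₃D, ht₃lt⟩ := exists_lt_of_csInf_lt hDne (show sInf D < t₁ + δ by linarith)
  exact ht₃D.2 (hagree t₃ ⟨csInf_le hDbdd ht₃D, ht₃lt.le⟩)

namespace DAPINetwork

variable {n : ℕ} {W : DAPINetwork n}

/-! ## §2 The DAE closed loop of Theorem 8 (ii) with load nodes: trajectory uniqueness from
consistent initial data (the well-posedness the stability statement presupposes) -/

/-- **Constraint differentiation, pointwise form.**  If `θ` is differentiable at `t` with inverter and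
secondary rows as in (load – closed loop)/(secondary control – closed loop) (`IsSolutionLoadsAt` at
`t`), the load constraints `m_l(θ(s)) = 0` hold at ALL times `s`, and `L_LL(θ(t))` is invertible,
then the error-coordinate state `x(s) = (θ(s), p(s) − D_Iω_avg)` satisfies `ẋ(t) = dlField θ* (x(t))`.
(The companion's `hasDerivAt_lphase_of_isSolutionLoadsAt` with its global solution hypothesis
replaced by what its proof uses.) [cite: SimpsonporcoDorflerBullo2013, App. C («eliminate the resulting algebraic equations, as in the proof of Theorem 2»)] -/
theorem hasDerivAt_lphase_of_isSolutionLoadsAt_at (hD : ∀ i, 0 ≤ W.Dc i) {θ : ℝ → Fin n → ℝ}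
    {p : ℝ → W.Inv → ℝ} {t : ℝ} (hsol : W.IsSolutionLoadsAt θ p t)
    (hL : ∀ (l : W.Load) (s : ℝ), W.mismatch (θ s) l.1 = 0) (θs : Fin n → ℝ)
    (hU : IsUnit (W.lapLL (θ t)).det) :
    HasDerivAt (fun s => W.lphase (θ s) (fun i => p s i - W.Dc i.1 * W.avgFrequency))
      (W.dlField θs (W.lphase (θ t) (fun i => p t i - W.Dc i.1 * W.avgFrequency))) t := by
  classical
  have _ := hD
  -- the angle velocities
  have hθex : ∀ j, ∃ w : ℝ, HasDerivAt (fun s => θ s j) w t := by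
    intro j
    by_cases hj : 0 < W.Dc j
    · exact ⟨_, (hsol.1 ⟨j, hj⟩).1⟩
    · exact (hsol.2 ⟨j, hj⟩).1
  choose Vθ hVθ using hθex
  have hVθ' : HasDerivAt θ Vθ t := hasDerivAt_pi.2 hVθ
  have hVI : ∀ i : W.Inv, Vθ i.1 = (W.Pstar i.1 - p t i - W.injection (θ t) i.1) / W.Dc i.1 :=
    fun i => (hVθ i.1).unique (hsol.1 i).1
  have hVL := loadVelocity_eq_elim_mulVec (W := W) hVθ' hL hU
  -- compare with the field
  set q : W.Inv → ℝ := fun i => p t i - W.Dc i.1 * W.avgFrequency with hq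
  have hmL : (fun l : W.Load => W.mismatch (θ t) l.1) = 0 := funext fun l => hL l t
  have hFI : W.dlFieldI θs (θ t) q = fun i : W.Inv => Vθ i.1 := by
    funext i
    simp only [dlFieldI, DroopNetwork.kronFieldI, hmL, Matrix.mulVec_zero, Pi.zero_apply, sub_zero]
    rw [hVI i, DroopNetwork.mismatch, DroopNetwork.shiftedInjection, hq, div_sub_div_same]
    congr 1
    ring
  have hquot : ∀ i j : W.Inv, q i / W.Dc i.1 - q j / W.Dc j.1 = p t i / W.Dc i.1 - p t j / W.Dc j.1 := by
    intro i j
    simp only [hq]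
    rw [sub_div, sub_div, mul_div_cancel_left₀ _ i.2.ne', mul_div_cancel_left₀ _ j.2.ne']
    ring
  have hFP : ∀ i : W.Inv, W.dlFieldP θs (θ t) q i
      = (W.Pstar i.1 - p t i - W.injection (θ t) i.1
          - ∑ j : W.Inv, W.comm i.1 j.1 * (p t i / W.Dc i.1 - p t j / W.Dc j.1)) / W.kgain i.1 := by
    intro i
    rw [dlFieldP, hFI]
    simp only [hquot, hVI i, mul_div_cancel₀ _ i.2.ne']
  have hθpart : (fun j' => W.lphase (θ t) q (Sum.inl j')) = θ t := rfl
  have hqpart : (fun i' => W.lphase (θ t) q (Sum.inr i')) = q := rfl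
  refine hasDerivAt_pi.2 fun kk => ?_
  cases kk with
  | inl j =>
    show HasDerivAt (fun s => θ s j) (W.dlField θs (W.lphase (θ t) q) (Sum.inl j)) t
    by_cases hj : 0 < W.Dc j
    · have hval : W.dlField θs (W.lphase (θ t) q) (Sum.inl j) = Vθ j := by
        have h : W.dlField θs (W.lphase (θ t) q) (Sum.inl j)
            = W.dlFieldI θs (fun j' => W.lphase (θ t) q (Sum.inl j'))
                (fun i' => W.lphase (θ t) q (Sum.inr i')) ⟨j, hj⟩ := by
          simp only [dlField, Sum.elim_inl, dif_pos hj]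
        rw [hθpart, hqpart, hFI] at h
        exact h
      rw [hval]; exact hVθ j
    · have hval : W.dlField θs (W.lphase (θ t) q) (Sum.inl j) = Vθ j := by
        have h : W.dlField θs (W.lphase (θ t) q) (Sum.inl j)
            = W.dlFieldL θs (fun j' => W.lphase (θ t) q (Sum.inl j'))
                (fun i' => W.lphase (θ t) q (Sum.inr i')) ⟨j, hj⟩ := by
          simp only [dlField, Sum.elim_inl, dif_neg hj]
        rw [hθpart, hqpart, dlFieldL, hFI, hmL, Matrix.mulVec_zero, add_zero, ← hVL] at h
        exact h
      rw [hval]; exact hVθ j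
  | inr i =>
    show HasDerivAt (fun s => p s i - W.Dc i.1 * W.avgFrequency)
      (W.dlField θs (W.lphase (θ t) q) (Sum.inr i)) t
    have hval : W.dlField θs (W.lphase (θ t) q) (Sum.inr i) = W.dlFieldP θs (θ t) q i := rfl
    rw [hval, hFP i]
    exact (hsol.1 i).2.sub_const (W.Dc i.1 * W.avgFrequency)

/-- **A forward solution solves the Kron-extended DAPI flow at every regular time `t > 0`**: with
the constraints only on `[0, ∞)` — apply the pointwise lemma to the curve frozen at negative times,
`s ↦ (θ(max(s,0)), p(max(s,0)))`, which agrees with `(θ, p)` near `t`.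
[cite: SimpsonporcoDorflerBullo2013, App. C] -/
theorem hasDerivAt_lphase_of_forward (hD : ∀ i, 0 ≤ W.Dc i) {θ : ℝ → Fin n → ℝ}
    {p : ℝ → W.Inv → ℝ} {t : ℝ} (ht : 0 < t) (hsol : W.IsSolutionLoadsAt θ p t)
    (hL : ∀ (l : W.Load) (s : ℝ), 0 ≤ s → W.mismatch (θ s) l.1 = 0) (θs : Fin n → ℝ)
    (hU : IsUnit (W.lapLL (θ t)).det) :
    HasDerivAt (fun s => W.lphase (θ s) (fun i => p s i - W.Dc i.1 * W.avgFrequency))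
      (W.dlField θs (W.lphase (θ t) (fun i => p t i - W.Dc i.1 * W.avgFrequency))) t := by
  set θ' : ℝ → Fin n → ℝ := fun s => θ (max s 0) with hθ'
  set p' : ℝ → W.Inv → ℝ := fun s => p (max s 0) with hp'
  have hev : ∀ᶠ s in 𝓝 t, max s 0 = s := by
    filter_upwards [Ioi_mem_nhds ht] with s hs
    exact max_eq_left (le_of_lt (mem_Ioi.1 hs))
  have hθt : θ' t = θ t := by simp only [hθ', max_eq_left ht.le]
  have hpt : p' t = p t := by simp only [hp', max_eq_left ht.le]
  -- `(θ', p')` is a solution AT `t`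
  have evθ : ∀ j, (fun s => θ' s j) =ᶠ[𝓝 t] (fun s => θ s j) := fun j => by
    filter_upwards [hev] with s hs
    simp only [hθ', hs]
  have evp : ∀ i, (fun s => p' s i) =ᶠ[𝓝 t] (fun s => p s i) := fun i => by
    filter_upwards [hev] with s hs
    simp only [hp', hs]
  have hsol' : W.IsSolutionLoadsAt θ' p' t := by
    refine ⟨fun i => ⟨?_, ?_⟩, fun l => ⟨?_, ?_⟩⟩
    · rw [hθt, hpt]; exact (hsol.1 i).1.congr_of_eventuallyEq (evθ i.1)
    · rw [hθt, hpt]; exact (hsol.1 i).2.congr_of_eventuallyEq (evp i)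
    · obtain ⟨w, hw⟩ := (hsol.2 l).1
      exact ⟨w, hw.congr_of_eventuallyEq (evθ l.1)⟩
    · rw [hθt]; exact (hsol.2 l).2
  have hL' : ∀ (l : W.Load) (s : ℝ), W.mismatch (θ' s) l.1 = 0 := fun l s =>
    hL l (max s 0) (le_max_right _ _)
  have hU' : IsUnit (W.lapLL (θ' t)).det := by rw [hθt]; exact hU
  have h := hasDerivAt_lphase_of_isSolutionLoadsAt_at hD hsol' hL' θs hU'
  rw [hθt, hpt] at h
  refine h.congr_of_eventuallyEq ?_
  filter_upwards [hev] with s hs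
  simp only [hθ', hp', hs]

/-- **UNIQUENESS of the solution of the DAPI differential-algebraic closed loop near the equilibrium
of SPDB2013 Theorem 8 (ii)** — the index-one DAE well-posedness that «locally exponentially stable»
presupposes (the print's «unique» in Theorem 8 (ii) is the uniqueness of the EQUILIBRIUM in
`Δ_G(γ) × ℝ^{|V_I|}`, a different statement, not claimed here).  Hypotheses of the companion's existence
theorem (`D ≥ 0`, an inverter, `k > 0` on `V_I`, `|Y|` and `c` symmetric, `θ*` an (Aux)-equilibrium,
both Hessian forms psd with kernel the constants).  Then there is `ρ > 0` such that for all initial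
data `(θ⁰, p⁰)` with `‖(θ⁰ − θ*, p⁰ − D_Iω_avg)‖ < ρ`, any two pairs `(θ, p)`, `(θ', p')` with these
initial values that solve (load – closed loop)/(secondary control – closed loop) at every `t > 0`
(`IsSolutionLoadsAt`), satisfy the load constraints at every `t ≥ 0` and have continuous error-state
on `[0, ∞)` coincide for all `t ≥ 0`.
[cite: SimpsonporcoDorflerBullo2013, §5 Theorem 8 (ii) («locally exponentially stable»: well-posedness presupposed) and App. C (p0016 L24); Khalil2002, Theorem 3.1] -/
theorem solution_unique_loads (hD : ∀ i, 0 ≤ W.Dc i) (i₀ : W.Inv)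
    (hk : ∀ i : W.Inv, 0 < W.kgain i.1) (hY : ∀ i j, W.Yabs i j = W.Yabs j i)
    (hcs : ∀ i j : W.Inv, W.comm i.1 j.1 = W.comm j.1 i.1) {θs : Fin n → ℝ}
    (hθs : W.IsAuxEquilibrium θs)
    (hpsd : ∀ u : Fin n → ℝ, 0 ≤ ∑ i, u i * ∑ j, W.linWeight θs i j * (u i - u j))
    (hker : ∀ u : Fin n → ℝ, ∑ i, u i * ∑ j, W.linWeight θs i j * (u i - u j) = 0 →
      ∃ a : ℝ, u = fun _ => a)
    (hcpsd : ∀ u : W.Inv → ℝ, 0 ≤ ∑ i, u i * ∑ j, W.comm i.1 j.1 * (u i - u j))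
    (hcker : ∀ u : W.Inv → ℝ, ∑ i, u i * ∑ j, W.comm i.1 j.1 * (u i - u j) = 0 →
      ∃ a : ℝ, u = fun _ => a) :
    ∃ ρ > 0, ∀ (θinit : Fin n → ℝ) (pinit : W.Inv → ℝ),
      ‖W.lphase (θinit - θs) (fun i => pinit i - W.Dc i.1 * W.avgFrequency)‖ < ρ →
      ∀ (θ θ' : ℝ → Fin n → ℝ) (p p' : ℝ → W.Inv → ℝ),
        θ 0 = θinit → p 0 = pinit → θ' 0 = θinit → p' 0 = pinit →
        (∀ t : ℝ, 0 < t → W.IsSolutionLoadsAt θ p t) →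
        (∀ t : ℝ, 0 < t → W.IsSolutionLoadsAt θ' p' t) →
        (∀ t : ℝ, 0 ≤ t → ∀ l : W.Load, W.Pstar l.1 = W.injection (θ t) l.1) →
        (∀ t : ℝ, 0 ≤ t → ∀ l : W.Load, W.Pstar l.1 = W.injection (θ' t) l.1) →
        ContinuousOn (fun t => W.lphase (θ t) (fun i => p t i - W.Dc i.1 * W.avgFrequency))
          (Ici 0) →
        ContinuousOn (fun t => W.lphase (θ' t) (fun i => p' t i - W.Dc i.1 * W.avgFrequency))
          (Ici 0) →
        ∀ t : ℝ, 0 ≤ t → θ t = θ' t ∧ p t = p' t := by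
  classical
  obtain ⟨ρ, hρ, k, hk', lam, hlam, H⟩ :=
    exists_dlSolution hD i₀ hk hY hcs hθs hpsd hker hcpsd hcker
  refine ⟨ρ, hρ, fun θinit pinit hinit θ θ' p p' hθ0 hp0 hθ'0 hp'0 hsol hsol' hcons hcons'
    hcont hcont' t ht => ?_⟩
  -- the regular reference solution from the same initial error-state
  set x : Fin n ⊕ W.Inv → ℝ :=
    W.lphase θinit (fun i => pinit i - W.Dc i.1 * W.avgFrequency) with hx
  have hxρ : ‖x - W.lphase θs 0‖ < ρ := by
    have e : x - W.lphase θs 0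
        = W.lphase (θinit - θs) (fun i => pinit i - W.Dc i.1 * W.avgFrequency) := by
      funext kk; cases kk <;> simp [hx, lphase]
    rw [e]; exact hinit
  obtain ⟨Xs, hXs0, hXs, hXsU, -⟩ := H x hxρ
  set O : Set (Fin n ⊕ W.Inv → ℝ) :=
    {y | (W.lapLL fun j => y (Sum.inl j)).det ≠ 0} with hO
  have hOopen : IsOpen O := isOpen_regular
  have hFO : ContDiffOn ℝ 1 (W.dlField θs) O := contDiffOn_dlField θs
  have hXsO : ∀ t, 0 ≤ t → Xs t ∈ O := fun t ht => (hXsU t ht).ne_zero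
  -- constraints in `mismatch` form
  have hmis : ∀ (φ : ℝ → Fin n → ℝ),
      (∀ t : ℝ, 0 ≤ t → ∀ l : W.Load, W.Pstar l.1 = W.injection (φ t) l.1) →
      ∀ (l : W.Load) (s : ℝ), 0 ≤ s → W.mismatch (φ s) l.1 = 0 := by
    intro φ hφ l s hs
    rw [DroopNetwork.mismatch, DroopNetwork.shiftedInjection,
      DroopNetwork.dc_load (N := W.toDroopNetwork) hD l, mul_zero, sub_zero, hφ s hs l, sub_self]
  -- every forward solution equals the reference solution
  have key : ∀ (φ : ℝ → Fin n → ℝ) (q : ℝ → W.Inv → ℝ), φ 0 = θinit → q 0 = pinit →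
      (∀ t : ℝ, 0 < t → W.IsSolutionLoadsAt φ q t) →
      (∀ t : ℝ, 0 ≤ t → ∀ l : W.Load, W.Pstar l.1 = W.injection (φ t) l.1) →
      ContinuousOn (fun t => W.lphase (φ t) (fun i => q t i - W.Dc i.1 * W.avgFrequency))
        (Ici 0) →
      ∀ t, 0 ≤ t →
        (fun s => W.lphase (φ s) (fun i => q s i - W.Dc i.1 * W.avgFrequency)) t = Xs t := by
    intro φ q hφ0 hq0 hφsol hφcons hφcont
    refine eq_of_regularSolution hOopen hFO hXs hXsO hφcont (fun t ht hreg => ?_) ?_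
    · exact hasDerivAt_lphase_of_forward hD ht (hφsol t ht) (hmis φ hφcons) θs
        (isUnit_iff_ne_zero.2 hreg)
    · show W.lphase (φ 0) (fun i => q 0 i - W.Dc i.1 * W.avgFrequency) = Xs 0
      rw [hXs0, hx, hφ0, hq0]
  have h1 := key θ p hθ0 hp0 hsol hcons hcont t ht
  have h2 := key θ' p' hθ'0 hp'0 hsol' hcons' hcont' t ht
  have h12 : W.lphase (θ t) (fun i => p t i - W.Dc i.1 * W.avgFrequency)
      = W.lphase (θ' t) (fun i => p' t i - W.Dc i.1 * W.avgFrequency) := h1.trans h2.symm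
  refine ⟨funext fun j => ?_, funext fun i => ?_⟩
  · have := congrFun h12 (Sum.inl j); simpa [lphase] using this
  · have := congrFun h12 (Sum.inr i); simpa [lphase] using this

/-- **WELL-POSEDNESS OF THE DAE CLOSED LOOP OF THEOREM 8 (ii) WITH LOAD NODES: exactly one solution
from every consistent initial condition near the equilibrium, with the exponential estimate.**  There are `ρ, k, λ > 0`
such that from every consistent `(θ⁰, p⁰)` with `‖(θ⁰ − θ*, p⁰ − D_Iω_avg)‖ < ρ` a solution
`(θ, p)` in the class {initial values; `IsSolutionLoadsAt` at every `t > 0`; load constraints at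
every `t ≥ 0`; continuous error-state on `[0, ∞)`} EXISTS (companion), every other one agrees with
it on `[0, ∞)`, and it satisfies the companion's estimate
`‖(θ(t) − (θ* + c𝟙), p(t) − D_Iω_avg)‖ ≤ k‖(θ⁰ − (θ* + c𝟙), p⁰ − D_Iω_avg)‖e^{−λt}`.
[cite: SimpsonporcoDorflerBullo2013, §5 Theorem 8 (ii) and App. C; Teschl2012, Cor. 2.15] -/
theorem existsUnique_solution_loads (hD : ∀ i, 0 ≤ W.Dc i) (i₀ : W.Inv)
    (hk : ∀ i : W.Inv, 0 < W.kgain i.1) (hY : ∀ i j, W.Yabs i j = W.Yabs j i)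
    (hcs : ∀ i j : W.Inv, W.comm i.1 j.1 = W.comm j.1 i.1) {θs : Fin n → ℝ}
    (hθs : W.IsAuxEquilibrium θs)
    (hpsd : ∀ u : Fin n → ℝ, 0 ≤ ∑ i, u i * ∑ j, W.linWeight θs i j * (u i - u j))
    (hker : ∀ u : Fin n → ℝ, ∑ i, u i * ∑ j, W.linWeight θs i j * (u i - u j) = 0 →
      ∃ a : ℝ, u = fun _ => a)
    (hcpsd : ∀ u : W.Inv → ℝ, 0 ≤ ∑ i, u i * ∑ j, W.comm i.1 j.1 * (u i - u j))
    (hcker : ∀ u : W.Inv → ℝ, ∑ i, u i * ∑ j, W.comm i.1 j.1 * (u i - u j) = 0 →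
      ∃ a : ℝ, u = fun _ => a) :
    ∃ ρ > 0, ∃ k > 0, ∃ lam > 0, ∀ (θinit : Fin n → ℝ) (pinit : W.Inv → ℝ),
      ‖W.lphase (θinit - θs) (fun i => pinit i - W.Dc i.1 * W.avgFrequency)‖ < ρ →
      (∀ l : W.Load, W.Pstar l.1 = W.injection θinit l.1) →
      ∃ (θ : ℝ → Fin n → ℝ) (p : ℝ → W.Inv → ℝ), (θ 0 = θinit ∧ p 0 = pinit ∧
          (∀ t : ℝ, 0 < t → W.IsSolutionLoadsAt θ p t) ∧
          (∀ t : ℝ, 0 ≤ t → ∀ l : W.Load, W.Pstar l.1 = W.injection (θ t) l.1) ∧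
          ContinuousOn (fun t => W.lphase (θ t) (fun i => p t i - W.Dc i.1 * W.avgFrequency))
            (Ici 0)) ∧
        (∀ (θ' : ℝ → Fin n → ℝ) (p' : ℝ → W.Inv → ℝ), θ' 0 = θinit → p' 0 = pinit →
          (∀ t : ℝ, 0 < t → W.IsSolutionLoadsAt θ' p' t) →
          (∀ t : ℝ, 0 ≤ t → ∀ l : W.Load, W.Pstar l.1 = W.injection (θ' t) l.1) →
          ContinuousOn (fun t => W.lphase (θ' t) (fun i => p' t i - W.Dc i.1 * W.avgFrequency))
            (Ici 0) → ∀ t : ℝ, 0 ≤ t → θ' t = θ t ∧ p' t = p t) ∧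
        ∀ t : ℝ, 0 ≤ t →
          ‖W.lphase (fun j => θ t j - (θs j + (∑ j', W.Dc j' * (θinit j' - θs j')
                - ∑ i : W.Inv, W.kgain i.1 * (pinit i - W.Dc i.1 * W.avgFrequency)) / ∑ j', W.Dc j'))
              (fun i => p t i - W.Dc i.1 * W.avgFrequency)‖
            ≤ k * ‖W.lphase (fun j => θinit j - (θs j + (∑ j', W.Dc j' * (θinit j' - θs j')
                - ∑ i : W.Inv, W.kgain i.1 * (pinit i - W.Dc i.1 * W.avgFrequency)) / ∑ j', W.Dc j'))
              (fun i => pinit i - W.Dc i.1 * W.avgFrequency)‖ * Real.exp (-lam * t) := by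
  obtain ⟨ρ₁, hρ₁, k, hk', lam, hlam, Hex⟩ :=
    exists_solution_loads hD i₀ hk hY hcs hθs hpsd hker hcpsd hcker
  obtain ⟨ρ₂, hρ₂, Hun⟩ := solution_unique_loads hD i₀ hk hY hcs hθs hpsd hker hcpsd hcker
  refine ⟨min ρ₁ ρ₂, lt_min hρ₁ hρ₂, k, hk', lam, hlam, fun θinit pinit hinit hcons0 => ?_⟩
  obtain ⟨θ, p, hθ0, hp0, hsol, hcons, hcont, hest⟩ :=
    Hex θinit pinit (lt_of_lt_of_le hinit (min_le_left _ _)) hcons0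
  refine ⟨θ, p, ⟨hθ0, hp0, hsol, hcons, hcont⟩,
    fun θ' p' hθ'0 hp'0 hsol' hcons' hcont' t ht => ?_, hest⟩
  exact Hun θinit pinit (lt_of_lt_of_le hinit (min_le_right _ _)) θ' θ p' p hθ'0 hp'0 hθ0 hp0
    hsol' hsol hcons' hcons hcont' hcont t ht

end DAPINetwork

end Literature.MathematicalPhysics.PowerSystems
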